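import Mathlib
import HarnessLib
import Summits.ResolutionOfSingularities.ResolutionOfSingularities.Theorems.WildQuotientsWildQuotientResolutionS1aKillFamily
import Summits.ResolutionOfSingularities.ResolutionOfSingularities.Theorems.WildQuotientsWildQuotientResolutionS1aJ22KillsIn

/-!
# S1a — THE PARALLEL KILL LEAF: finitely many principal centres with pairwise disjoint supports kill in ONE move (`KillsIn 1`)

[OURS · L1 W4.5c · lead-1 g14; plan-1 RULING R-F15k (b4) «a ★ PARALLEL KILL LEAF gluing finitely many node certificates with disjoint supports into one admissible
centre», on top of the gen-8 family tools ✓`isPrincipalCentre_infRees_of_disjoint` / ✓`exists_chart_at_support` / ✓`isPrincipalCentreChart_infRees` (`…S1aKillFamily`,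
`…S1aCentreGluing`) and the root-kill leaf ✓`killsIn_one_of_coveringKill` (`…S1aJ22KillsIn`)] — NOT statements of the manuscript; counted 0; AI-level work, weaker
than expert review. Crux stmt-ResolutionOfSingularities-17941 `CyclicQuotientFourfolds`, line `s1a-logminvertex` v13 (`stub_reachLowerInFX`). The second (and last)
move of the conjectured two-shot tree of the line-arrangement class `L_d` (Q-R3 answer): after the symmetric root move the `d` residual components are pairwise
disjoint and each carries a chain-type certificate on a chart avoiding the others.

* ★★★ `killsIn_one_of_disjointPrincipalFamily` — model `M` with a Noetherian base and node-atlas data `𝔄`; finitely many PRINCIPAL centres `𝒦ᵢ` of one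
  Veronese degree `d` with PAIRWISE DISJOINT supports; designated principal-centre charts `W_c` (of the member `ix c`) each DISJOINT from the supports of the
  other members and together covering `F_𝔄`. Then `KillsIn 1 M`: the glued centre `⨅ᵢ 𝒦ᵢ` is principal, the `W_c` and the charts of ✓`exists_chart_at_support`
  are principal-centre charts of it covering its support and `F_𝔄`, so ✓`killsIn_one_of_coveringKill` applies.
* `killsIn_one_of_disjointPrincipalFamily_datum` — the datum form (`hasNoetherianBase_of_datum`).
-/

set_option linter.dupNamespace false

noncomputable section

open CategoryTheory Limits AlgebraicGeometry TopologicalSpace Topology Opposite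
open Literature.AlgebraicGeometry.Resolution Literature.AlgebraicGeometry.RelativeSpec
open Summit.ResolutionOfSingularities.ResolutionOfSingularities.Theorems.WildQuotientResolution.S1
open Summit.ResolutionOfSingularities.ResolutionOfSingularities.Theorems.WildQuotientResolution.S1.NodeAtlas
open Summit.ResolutionOfSingularities.ResolutionOfSingularities.Theorems.WildQuotientResolution.S1.NpFrame
open Summit.ResolutionOfSingularities.ResolutionOfSingularities.Theorems.WildQuotientResolution.S1.CentreGluing
open Summit.ResolutionOfSingularities.ResolutionOfSingularities.Theorems.WildQuotientResolution.S1.KillFamily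
open Summit.ResolutionOfSingularities.ResolutionOfSingularities.Theorems.WildQuotientResolution.S1.KillGlue

namespace Summit.ResolutionOfSingularities.ResolutionOfSingularities.Theorems.WildQuotientResolution.S1.GameFrame.GModel

variable {p : ℕ} {X' X₁ : Scheme.{0}} {q : X' ⟶ X₁} {G : Type} [Group G] {ρ : G →* Aut X'} {g₀ : G}

/-- ★★★ **THE PARALLEL KILL LEAF.** Model `M` (Noetherian base) with node-atlas data `𝔄`; a finite family of PRINCIPAL centres `𝒦ᵢ` of one Veronese degree
`d > 0` with pairwise DISJOINT supports; designated charts `W_c`, each a principal-centre chart of its member `𝒦_{ix c}` DISJOINT from the supports of the other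
members, covering the formal locus `F_𝔄`. Then `KillsIn 1 M` through the glued centre `⨅ᵢ 𝒦ᵢ`. [OURS · L1 W4.5c · R-F15k (b4); NOT a statement of the manuscript] -/
theorem killsIn_one_of_disjointPrincipalFamily [Finite G] (hp : p.Prime) (hG : ∀ g : G, g ∈ Subgroup.zpowers g₀)
    (M : GModel p q G ρ g₀) (hB : M.HasNoetherianBase) (𝔄 : NodeAtlasData p M.act g₀)
    {ι : Type} [Finite ι] (𝒦 : ι → ReesFiltration M.V) {d : ℕ} (hd : 0 < d) (hprin : ∀ i, IsPrincipalCentre p M.act g₀ (𝒦 i) d)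
    (hdisj : Pairwise fun i j => Disjoint ((((𝒦 i).ideal d).support : Set M.V)) (((𝒦 j).ideal d).support))
    {κ : Type} (ix : κ → ι) (W : κ → M.act.StableAffineOpens) (hW : ∀ c, IsPrincipalCentreChart p M.act g₀ (𝒦 (ix c)) d (W c))
    (hWoff : ∀ c j, j ≠ ix c → Disjoint (((W c).1 : Set M.V)) (((𝒦 j).ideal d).support))
    (hF : 𝔄.fLocus ⊆ ⋃ c, ((W c).1 : Set M.V)) : KillsIn 1 M := by
  classical
  haveI : Fintype ι := Fintype.ofFinite ι
  have hprin' : IsPrincipalCentre p M.act g₀ (infRees 𝒦) d := isPrincipalCentre_infRees_of_disjoint M 𝒦 hd hprin hdisj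
  -- at every point of a member's support: a principal-centre chart of the glued centre
  have hat : ∀ v : {v : M.V // ∃ i, v ∈ ((((𝒦 i).ideal d).support : Set M.V))},
      ∃ O : M.act.StableAffineOpens, (v : M.V) ∈ O.1 ∧ IsPrincipalCentreChart p M.act g₀ (infRees 𝒦) d O := by
    rintro ⟨v, i₀, hvs⟩
    obtain ⟨O, hvO, -, hO, hj⟩ := exists_chart_at_support M 𝒦 hd hprin hdisj hvs (U₀ := ⊤) (fun g => Opens.map_top _) trivial
    exact ⟨O, hvO, isPrincipalCentreChart_infRees (ρ := M.act) (g₀ := g₀) 𝒦 i₀ hO hj⟩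
  choose Oat hOat_mem hOat using hat
  -- the designated family: the given charts and the charts at the supports
  let Oc : κ ⊕ {v : M.V // ∃ i, v ∈ ((((𝒦 i).ideal d).support : Set M.V))} → M.act.StableAffineOpens := fun s => Sum.elim W Oat s
  have hOc : ∀ s, IsPrincipalCentreChart p M.act g₀ (infRees 𝒦) d (Oc s) := by
    rintro (c | v)
    · refine isPrincipalCentreChart_infRees (ρ := M.act) (g₀ := g₀) 𝒦 (ix c) (hW c) fun hO j => ?_
      by_cases hj : j = ix c
      · subst hj
        exact Or.inr fun n => rfl
      · exact Or.inl (filtration_eq_top_of_disjoint (𝒦 j) hd ⟨(W c).1, hO⟩ (hWoff c j hj))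
    · exact hOat v
  have hcov : ((((infRees 𝒦).ideal d).support : Set M.V)) ⊆ ⋃ s, ((Oc s).1 : Set M.V) := by
    intro v hv
    have hv' : v ∈ ⋃ i, ((((𝒦 i).ideal d).support : Set M.V)) := by
      rw [infRees_ideal] at hv
      exact coe_support_iInf_subset (fun i => (𝒦 i).ideal d) hv
    obtain ⟨i, hvi⟩ := Set.mem_iUnion.mp hv'
    exact Set.mem_iUnion.mpr ⟨Sum.inr ⟨v, i, hvi⟩, hOat_mem _⟩
  have hF' : 𝔄.fLocus ⊆ ⋃ s, ((Oc s).1 : Set M.V) := fun v hv => by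
    obtain ⟨c, hc⟩ := Set.mem_iUnion.mp (hF hv)
    exact Set.mem_iUnion.mpr ⟨Sum.inl c, hc⟩
  exact killsIn_one_of_coveringKill hp hG M hB 𝔄 (infRees 𝒦) d hprin' Oc hOc hcov hF'

/-- **The datum form** (`hasNoetherianBase_of_datum`: over a field with `X₁ → Spec k` locally of finite type and `q` finite every model has a Noetherian base).
[OURS · L1 W4.5c · R-F15k (b4)] -/
theorem killsIn_one_of_disjointPrincipalFamily_datum [Finite G] (hp : p.Prime) (hG : ∀ g : G, g ∈ Subgroup.zpowers g₀)
    {k : Type} [Field k] (f : X₁ ⟶ Spec (.of k)) [LocallyOfFiniteType f] [IsFinite q]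
    (M : GModel p q G ρ g₀) (𝔄 : NodeAtlasData p M.act g₀)
    {ι : Type} [Finite ι] (𝒦 : ι → ReesFiltration M.V) {d : ℕ} (hd : 0 < d) (hprin : ∀ i, IsPrincipalCentre p M.act g₀ (𝒦 i) d)
    (hdisj : Pairwise fun i j => Disjoint ((((𝒦 i).ideal d).support : Set M.V)) (((𝒦 j).ideal d).support))
    {κ : Type} (ix : κ → ι) (W : κ → M.act.StableAffineOpens) (hW : ∀ c, IsPrincipalCentreChart p M.act g₀ (𝒦 (ix c)) d (W c))
    (hWoff : ∀ c j, j ≠ ix c → Disjoint (((W c).1 : Set M.V)) (((𝒦 j).ideal d).support))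
    (hF : 𝔄.fLocus ⊆ ⋃ c, ((W c).1 : Set M.V)) : KillsIn 1 M :=
  killsIn_one_of_disjointPrincipalFamily hp hG M (hasNoetherianBase_of_datum f M) 𝔄 𝒦 hd hprin hdisj ix W hW hWoff hF

end Summit.ResolutionOfSingularities.ResolutionOfSingularities.Theorems.WildQuotientResolution.S1.GameFrame.GModel

end
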